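import Mathlib
import Summits.ValiantsHypothesis.ValiantsHypothesis.Theses.DivisionGap

/-!
# Sketch — first lemmas of three crux-idea cards for `ZeroOneTransfer` (stmt-ValiantsHypothesis-5066)

Planner sketch (crux-ideate round 1, ideator 3). Nothing here is proved; each `def … : Prop` is the
"First lemma" of one idea card and must merely elaborate over existing declarations.

* `ProjectionClosure`   — card `plabic-koev-positroid-engine` (closure of division complexity under
  monotone projections, via Jukna–Seiwert–Sergeev's reciprocal-input elimination).
* `UnimodularRigidity`  — card `unimodular-rigidity-ksum-gluing` (0/1 ⇒ totally unimodular).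
* `GradedStarMesh`      — card `cyclotomic-graded-star-mesh` (ζ₆-connection Laplacians are
  division-easy with nonnegative real coefficients).
-/

namespace Summit.ValiantsHypothesis.ValiantsHypothesis.Cruxes.ZeroOneTransfer.Sketch

open Literature.Computability.AlgebraicComplexity MvPolynomial
open scoped NNReal BigOperators

/-- Division complexity in the Hrubeš–Yehudayoff normal form: the least `L₊(f·h) + L₊(h)` is at most
`s` — spelled existentially exactly as in the crux `ZeroOneTransfer`. -/
def DivLE {σ : Type} (f : MvPolynomial σ ℝ≥0) (s : ℕ) : Prop :=
  ∃ h : MvPolynomial σ ℝ≥0, h ≠ 0 ∧ complexity (f * h) + complexity h ≤ s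

/-- FIRST LEMMA of card `plabic-koev-positroid-engine` (closure calculus, step 1):
division complexity is closed under MONOTONE PROJECTIONS (variables ↦ variables or `0`; nonnegative
constants are then free), with a polynomial overhead.  Proof sketch: send every killed variable to
one fresh variable `t` (no cancellation over `ℝ≥0`, so `h(x,t,…,t) ≠ 0`), divide `g = f·h` and `h`
by the exact power `t^a ∥ h` using the reciprocal input `1/t`, eliminate the reciprocal input by
JuknaSeiwertSergeev2022 Thm 1 (`(+,·,1/xᵢ)` size `s` ⇒ `(+,·)` size `O(n s²)`), then set `t = 0`. -/
def ProjectionClosure : Prop :=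
  ∃ C : ℕ, ∀ (σ τ : Type) [Fintype σ] [Fintype τ] (π : σ → Option τ)
    (f : MvPolynomial σ ℝ≥0) (s : ℕ), DivLE f s →
      DivLE (MvPolynomial.bind₁ (fun i => (π i).elim 0 MvPolynomial.X) f)
        (C * (Fintype.card σ + 1) * (s + 1) ^ 2)

/-- FIRST LEMMA of card `unimodular-rigidity-ksum-gluing`: a real `k × n` matrix all of whose
maximal minors lie in `{0, 1, -1}`, one of them nonzero, becomes TOTALLY unimodular after left
multiplication by a unimodular `k × k` matrix (take `U = V_B₀⁻¹`).  With Cauchy–Binet this is the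
rigidity step "a 0/1-coefficient polynomial `det (V·diag x·Vᵀ)` is the basis generating polynomial
of a REGULAR matroid", which feeds Seymour's decomposition. -/
def UnimodularRigidity : Prop :=
  ∀ (k n : ℕ) (V : Matrix (Fin k) (Fin n) ℝ),
    (∀ c : Fin k → Fin n, (V.submatrix id c).det = 0 ∨ (V.submatrix id c).det = 1 ∨
      (V.submatrix id c).det = -1) →
    (∃ c : Fin k → Fin n, (V.submatrix id c).det ≠ 0) →
    ∃ U : Matrix (Fin k) (Fin k) ℝ, (U.det = 1 ∨ U.det = -1) ∧
      ∀ (m : ℕ) (r : Fin m → Fin k) (c : Fin m → Fin n),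
        ((U * V).submatrix r c).det = 0 ∨ ((U * V).submatrix r c).det = 1 ∨
          ((U * V).submatrix r c).det = -1

/-- The primitive sixth root of unity `ζ₆ = e^{iπ/3}`; `|1 - ζ₆|² = 1` is what makes a twisted cycle
count ONCE. -/
noncomputable def zeta6 : ℂ := Complex.exp (↑Real.pi * Complex.I / 3)

/-- The `ζ₆`-connection Laplacian of the complete graph on `Fin n` with symmetrised conductances
`x_{ij} + x_{ji}` and antisymmetric twist classes `k`. -/
noncomputable def connLaplacian (n : ℕ) (k : Fin n → Fin n → ZMod 6) :
    Matrix (Fin n) (Fin n) (MvPolynomial (Fin n × Fin n) ℂ) :=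
  Matrix.of fun i j =>
    if i = j then ∑ l : Fin n, (if l = i then 0 else (X (i, l) + X (l, i)))
    else -((X (i, j) + X (j, i)) * C (zeta6 ^ (k i j).val))

/-- FIRST LEMMA of card `cyclotomic-graded-star-mesh` (the new positivity engine): for antisymmetric
twists the determinant of the `ζ₆`-connection Laplacian is (i) the complexification of a polynomial
with NONNEGATIVE real coefficients (Forman–Kenyon: `Σ_{CRSF} x^F ∏_{cycles} |1 - ζ₆^{w(C)}|²`) and
(ii) division-easy with a polynomial bound — by the `ℤ/6`-GRADED star–mesh elimination (pivot
`p_v = m_v + L_v + ½(R₁+R₅) + 3/2 (R₂+R₄) + 2R₃`; toy-verified exactly on random instances,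
kit job j008386). -/
def GradedStarMesh : Prop :=
  ∃ c : ℕ, ∀ (n : ℕ) (k : Fin n → Fin n → ZMod 6), (∀ i j, k j i = -k i j) →
    ∃ P : MvPolynomial (Fin n × Fin n) ℝ≥0,
      MvPolynomial.map (Complex.ofRealHom.comp NNReal.toRealHom) P = (connLaplacian n k).det ∧
      DivLE P (c * (n + 1) ^ c)

/-- Sanity: the crux decl is in scope (the cards' lines must end in it BY NAME at plan stage). -/
example : Prop := Summit.ValiantsHypothesis.ValiantsHypothesis.Theses.DivisionGap.ZeroOneTransfer

end Summit.ValiantsHypothesis.ValiantsHypothesis.Cruxes.ZeroOneTransfer.Sketch
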